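import Mathlib.NumberTheory.LSeries.Basic
import Literature.NumberTheory.EllipticCurves.NewformAbelianVariety
import HarnessLib

/-!
# Kato's finiteness of the Mordell–Weil group of `A_g` when `L(g, 1) ≠ 0`
# (Astérisque 295, Cor. 14.3), over the interface `NewformAbelianVariety`

K. Kato, *`p`-adic Hodge theory and values of zeta functions of modular forms*, Astérisque 295
(2004), §14, proves (Thm. 14.2 (2), p. 235): for a normalised newform `f` of even weight `k` and
level `N`, a finite abelian extension `K/ℚ` and a character `χ` of `Gal(K/ℚ)` with
`L(f, χ, k/2) ≠ 0`, the `χ`-part of the Selmer group of every Galois-stable lattice of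
`V_{F_λ}(f)(k/2)` over `K` is finite; and deduces (Cor. 14.3, p. 235): for an abelian variety
`A/ℚ` which is a quotient of `J₁(N)`, `K/ℚ` finite abelian and `χ` a character of `Gal(K/ℚ)`
with `L(A, χ, 1) ≠ 0`, (1) the `χ`-part of `Sel(K, A)` is finite and (2) the `χ`-part
`A(K)^(χ)` of the Mordell–Weil group is finite (earlier, for `K = ℚ`: Kolyvagin–Logachev 1989,
with the analytic input of Bump–Friedberg–Hoffstein 1990 / Murty–Murty 1991).

The tree vendors part (2) for ELLIPTIC CURVES (`A = E`, `[K_f : ℚ] = 1`) in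
`KatoTwistedFiniteness.lean` (`kato_finite_chiPart_of_twistedLValue_ne_zero`, any cyclotomic `K`)
and `PAdicBSD.lean` (`kato_finite_of_L_one_ne_zero`, `K = ℚ`). This file vendors, as ONE NAMED
FACT (D-0014), the case `K = ℚ`, `χ = 1` of part (2) for the abelian variety `A_g` of an
ARBITRARY weight-two newform `g ∈ S₂(Γ₀(N))` (coefficient field `K_g` of any degree), stated
over the tree's interface `Literature.NumberTheory.EllipticCurves.ModularForms.NewformAbelianVariety g`
(file `NewformAbelianVariety.lean`, whose module docstring announces exactly this vendoring:
"`L(g, 1) ≠ 0 ⇒ A_g(ℚ)` finite (Kato 2004, Cor. 14.3) for non-rational `g`; those results are to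
be vendored over this interface"):

* `Literature.NumberTheory.EllipticCurves.kato_finite_mordellWeil_of_newformAbelianVariety` —
  for `g` a newform (`IsNewform0 g`), `D : NewformAbelianVariety g`, and an entire function `Λ`
  agreeing with the `L`-series `∑ aₙ(g) n⁻ˢ` on `re s > 2` (it exists by Hecke and is unique by
  the identity theorem, so `Λ 1` IS `L(g, 1)`): `Λ 1 ≠ 0 ⇒ A_g(ℚ) = D.A.Points ℚ` is finite.

## Why this is Cor. 14.3 (2) and nothing more

* `D.A` versus Kato's `A`. Kato's corollary is about quotients of `J₁(N)`; Shimura's optimal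
  quotient `A_g' = J₀(N)/I_g J₀(N)` (Diamond–Shurman Def. 6.6.3) is one (`J₁(N) → J₀(N) → A_g'`),
  with `L(A_g', s) = ∏_{σ : K_g → ℂ} L(g^σ, s)` (Shimura 1971, Thm. 7.15; Carayol). The interface
  records, for every prime `p` and every `ℓ ∤ N p`, the characteristic polynomial
  `∏_σ (X² − σ(a_ℓ(g)) X + ℓ)` of Frobenius on `T_p(D.A)` (field `charpoly_frob`) and
  `dim D.A = [K_g : ℚ]` (`dim_eq`); the same hold for `A_g'` (Rohrlich 1997, Thm. 4 (1); this is the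
  content of the tree's existence fact `IsNewform0.nonempty_newformAbelianVariety`). By Faltings
  1983 (semisimplicity of `V_p` and the isogeny theorem, Satz 4 and Korollar 2) two abelian
  varieties over `ℚ` whose Frobenius characteristic polynomials agree at almost all `ℓ` are
  `ℚ`-isogenous, so `D.A ~ A_g'`; and finiteness of the Mordell–Weil group is an isogeny invariant
  (an isogeny `A → B` of degree `d` and its quasi-inverse give `A(ℚ) → B(ℚ) → A(ℚ)` equal to
  multiplication by `d`, whose kernel `A(ℚ)[d]` is finite). Hence Cor. 14.3 (2) for `A_g'` with
  `K = ℚ`, `χ = 1` gives the statement below for every `D`.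
* `L(g, 1) ≠ 0` versus `L(A_g', 1) ≠ 0`. Kato's proof of Cor. 14.3 applies Thm. 14.2 (2) to the
  newforms occurring in `A`; for `f = g` the hypothesis is exactly `L(g, 1) ≠ 0` and the conclusion
  already kills `A_g(ℚ) ⊗ ℚ` (a `K_g`-vector space whose `λ`-component vanishes). Independently,
  the vanishing of `L(g^σ, 1)` does not depend on `σ` (Shimura 1977, Thm. 1: `L(g^σ, 1)/u⁺_{g^σ}`
  is the `σ`-conjugate of `L(g, 1)/u⁺_g`), so `L(g, 1) ≠ 0 ⇔ L(A_g', 1) = ∏_σ L(g^σ, 1) ≠ 0`.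
* "`L(g, 1) ≠ 0`" is spelled, exactly as in the tree's other Kato facts
  (`kato_finite_chiPart_of_twistedLValue_ne_zero`, `exists_differentiable_eq_twistedLSeries`),
  through an entire `Λ` with `Λ s = LSeries (fun n ↦ aₙ(g)) s` for `re s > 2` (the half-plane of
  absolute convergence in weight `2`; Mathlib `LSeries`, period-`1` `q`-expansion coefficients
  `(qExpansion 1 ⇑g).coeff n` = the tree's `cuspCoeff g n`) and `Λ 1 ≠ 0`; no `CuspFormLFunction`
  import is needed for the statement.

## What is NOT here

* Part (1) of Cor. 14.3 (finiteness of `Ш(A_g/ℚ)[p^∞]`, indeed of the Selmer group) and the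
  twisted / `χ`-part versions over abelian `K` — TODO(general form): `K` finite abelian, `χ`
  arbitrary, and part (1), as printed.
* Any converse (`A_g(ℚ)` finite ⇒ `L(g, 1) ≠ 0` is open beyond what Gross–Zagier–Kolyvagin give).
* A proof: the statement rests on the Euler system of Beilinson–Kato elements; it is literature
  debt (`kato_finite_mordellWeil_of_newformAbelianVariety_holds` does not exist).

Consumers: route ShadowIsolation of the BSD summit, crux `PhantomShadow`
(stmt-BirchSwinnertonDyer-15787), whose registered skeleton stub `stub_katoFinite` is this
statement verbatim.

## References

* K. Kato, *`p`-adic Hodge theory and values of zeta functions of modular forms*, Astérisque 295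
  (2004), 117–290: Thm. 14.2 (2) and Cor. 14.3 (2), p. 235. [Kato2004Asterisque]
* V. A. Kolyvagin, D. Yu. Logachëv, *Finiteness of the Shafarevich–Tate group and the group of
  rational points for some modular abelian varieties*, Algebra i Analiz 1 (1989), 171–196.
* G. Faltings, *Endlichkeitssätze für abelsche Varietäten über Zahlkörpern*, Invent. Math. 73
  (1983), Satz 4, Korollar 2. [Faltings1983Endlichkeit]
* G. Shimura, *Introduction to the Arithmetic Theory of Automorphic Functions* (1971), Thm. 7.14,
  Thm. 7.15. [ShimuraIATAF1971] — G. Shimura, *On the periods of modular forms*, Math. Ann. 229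
  (1977), Thm. 1. [Shimura1977]
* D. E. Rohrlich, *Modular curves, Hecke correspondences, and L-functions* (1997), §3.7 Thm. 4.
  [RohrlichCSS1997]
-/

noncomputable section

open scoped MatrixGroups ModularForm
open CongruenceSubgroup UpperHalfPlane

namespace Literature.NumberTheory.EllipticCurves

open ModularForms

/-- **Kato's theorem: `L(g, 1) ≠ 0 ⇒ A_g(ℚ)` is finite, for a weight-two newform `g` of any
coefficient degree** (K. Kato, Astérisque 295 (2004), Cor. 14.3 (2), p. 235, of Thm. 14.2 (2);
for `K = ℚ` earlier Kolyvagin–Logachev 1989). As printed (Cor. 14.3): "Let `A` be an abelian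
variety over `ℚ` such that there is a surjective homomorphism `J₁(N) → A` for some `N ≥ 1` […].
Let `K` be a finite abelian extension of `ℚ`, let `χ : Gal(K/ℚ) → ℂˣ` be a character, and assume
`L(A, χ, 1) ≠ 0`. Then: (1) The `χ`-part `Sel(K, A ⊗_ℚ K)^(χ)` of `Sel(K, A ⊗_ℚ K)` is finite.
(2) The `χ`-part `A(K)^(χ)` is finite." This is part (2) with `K = ℚ`, `χ = 1` (so
`A(K)^(χ) = A(ℚ)`) for `A = A_g`, the abelian variety of a newform `g ∈ S₂(Γ₀(N))`
(`IsNewform0 g`), stated over the interface `NewformAbelianVariety g`: for every such datum `D`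
(an abelian variety `D.A/ℚ` with Hecke action, `dim D.A = [K_g : ℚ]`, and Frobenius characteristic
polynomials `∏_σ (X² − σ(a_ℓ(g)) X + ℓ)` on `T_p(D.A)` for all `ℓ ∤ N p` — which pins `D.A` down
up to `ℚ`-isogeny: it is isogenous to Shimura's optimal quotient `A_g' = J₀(N)/I_g J₀(N)`, a
quotient of `J₁(N)` with `L(A_g', s) = ∏_σ L(g^σ, s)`, by Faltings' isogeny theorem, and finiteness
of the Mordell–Weil group is an isogeny invariant) and every entire function `Λ` agreeing with the
`L`-series `∑ₙ aₙ(g) n⁻ˢ` (`aₙ(g) = (qExpansion 1 ⇑g).coeff n`, Mathlib `LSeries`) on the half-plane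
`re s > 2` of absolute convergence (such `Λ` exists by Hecke 1936 and is unique, so `Λ 1 = L(g, 1)`):
if `Λ 1 ≠ 0` then `A_g(ℚ) = D.A.Points ℚ` is finite. Kato's hypothesis `L(A_g', 1) ≠ 0` is
`∏_σ L(g^σ, 1) ≠ 0`; his proof applies Thm. 14.2 (2) newform by newform, where for `f = g` the
hypothesis is `L(g, 1) ≠ 0` and the conclusion already kills `A_g(ℚ) ⊗ ℚ` (a `K_g`-vector space),
and in any case `L(g^σ, 1) = 0 ⇔ L(g, 1) = 0` (Shimura 1977, Thm. 1). Part (1), twists and general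
abelian `K` are not vendored (module docstring).
-- TODO(general form): `K` finite abelian over `ℚ`, `χ`-parts, and part (1) (Selmer / `Ш`).
[cite: Kato2004Asterisque, Cor. 14.3 (2) (p. 235)] -/
def kato_finite_mordellWeil_of_newformAbelianVariety : Prop :=
  ∀ (N : ℕ) [NeZero N] (g : CuspForm (Gamma0 N) 2), IsNewform0 g →
    ∀ (D : NewformAbelianVariety g) (Λ : ℂ → ℂ), Differentiable ℂ Λ →
      (∀ s : ℂ, 2 < s.re → Λ s = LSeries (fun m ↦ (qExpansion 1 ⇑g).coeff m) s) → Λ 1 ≠ 0 →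
        Finite (D.A.Points ℚ)

/-- Contrapositive, consumer form of `kato_finite_mordellWeil_of_newformAbelianVariety`: under
Kato's theorem, if `A_g(ℚ)` is infinite then every entire continuation `Λ` of `∑ aₙ(g) n⁻ˢ`
(`re s > 2`) vanishes at `s = 1`, i.e. `L(g, 1) = 0` (Kato 2004, Cor. 14.3 (2), read backwards).
[cite: Kato2004Asterisque, Cor. 14.3 (2) (p. 235)] -/
theorem apply_one_eq_zero_of_infinite_mordellWeil_of_kato
    (hK : kato_finite_mordellWeil_of_newformAbelianVariety) {N : ℕ} [NeZero N]
    {g : CuspForm (Gamma0 N) 2} (hg : IsNewform0 g) (D : NewformAbelianVariety g)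
    (hinf : Infinite (D.A.Points ℚ)) {Λ : ℂ → ℂ} (hΛ : Differentiable ℂ Λ)
    (hΛeq : ∀ s : ℂ, 2 < s.re → Λ s = LSeries (fun m ↦ (qExpansion 1 ⇑g).coeff m) s) :
    Λ 1 = 0 := by
  by_contra h1
  haveI : Finite (D.A.Points ℚ) := hK N g hg D Λ hΛ hΛeq h1
  exact hinf.not_finite ‹_›

end Literature.NumberTheory.EllipticCurves

end
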